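import Mathlib
import Literature.NumberTheory.LFunctions.DirichletLAtOneCotangent
import Literature.NumberTheory.LFunctions.CotangentCharacterSum
import Literature.NumberTheory.Transcendental.OkadaLinearIndependence
import HarnessLib

/-!
# Okada's theorem for `k = 1` (Chowla's cotangent theorem): the values `cot(πa/q)` are
# `ℚ`-linearly independent on every half-system of units mod `q`

Topic `Literature/NumberTheory/Transcendental`. Proofs-only file (theorems only, no definition, no named
fact). It supplies the case `k = 1`, WITH GENERAL HALF-SYSTEMS, that the statement file
`OkadaLinearIndependence.lean` deliberately left out («Deliberately NOT here: the case `k = 1` and general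
half-systems `T` of Okada's printed statement … the values `cot^{(k−1)}(πa/q)` themselves»):

> **Okada's theorem, `k = 1`** [Okada1981, Theorem] = [GunRammurtyRath2011, Lemma 1] (S. Chowla 1970
> for `q` prime). Let `q ≥ 3` and let `T` be a set of `φ(q)/2` coprime residues mod `q` with
> `T ∪ (−T) = (ℤ/q)^×`. Then the real numbers `cot(πa/q)`, `a ∈ T`, are linearly independent over `ℚ`.

* `okada_linearIndependent_cot_of_units` — for `q ≥ 2` and ANY family of units `v_i` mod `q`, pairwise
  distinct and with no `v_i ≡ −v_j`, the numbers `cot(π ṽ_i/q)` (`ṽ ∈ [0, q)` the representative) are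
  `ℚ`-linearly independent (every half-system `T` of the printed statement is such a family);
* `okada_linearIndependent_cot` — the half-system `1 ≤ a < q/2`, `(a, q) = 1` of the statement file's
  index type `{a : ℕ // 2a < q ∧ Nat.Coprime a q}`: for `q ≥ 3` the `φ(q)/2` numbers `cot(πa/q)` are
  `ℚ`-linearly independent.

Route = the five steps of `OkadaLinearIndependenceProofs.lean` (the `k ≥ 2` Hurwitz form, P1 g49) with the
Bernoulli–Fourier expansion replaced by the finite Fourier expansion of the cotangent and `L(k, χ) ≠ 0`
replaced by Dirichlet's `L(1, χ) ≠ 0`: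
* (A) `cot(π x̃/q) = i (1 + (2/q) Σ_{j<q} j ζ_q^{(jx)~})` for `x ≢ 0` (`ζ_q = e^{2πi/q}`; the tree's
  `LFunctions.natCast_mul_pi_mul_cot_eq`, i.e. `i cot(πa/q) = (1 + ζ_q^a)/(1 − ζ_q^a) ∈ ℚ(ζ_q)`
  expanded), so `−i Σ_l c_l cot(π ṽ_l/q)` is a RATIONAL polynomial in `ζ_q` (`Okada.aeval_exp_pow_cotPoly`);
* (B) GALOIS TRANSPORT (`Okada.cot_relation_transport`): `minpoly_ℚ(ζ_q) = Φ_q = minpoly_ℚ(ζ_q^t)` for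
  `(t, q) = 1` (Mathlib `cyclotomic_eq_minpoly_rat`), so a rational relation `Σ_l c_l cot(π ṽ_l/q) = 0`
  implies `Σ_l c_l cot(π (v_l t)~/q) = 0` for every `t` coprime to `q`;
* (C) `Σ_{r mod q} χ(r) cot(π r̃/q) = (2q/π) L(1, χ) ≠ 0` for every ODD Dirichlet character `χ` mod `q`
  (`LFunctions.sum_char_mul_cot_ne_zero_of_odd`, file `DirichletLAtOneCotangent.lean`);
* (D) twisting the relation at `t` by `χ(t)` and summing over `t`:
  `(Σ_l c_l χ(v_l)⁻¹) · Σ_r χ(r) cot(π r̃/q) = 0`, whence `(1 − χ(−1)) Σ_l c_l χ(v_l)⁻¹ = 0` for EVERY `χ`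
  (`Okada.cot_sum_coeff_char_inv_eq_zero`); summing `(1 − χ(−1))(Σ_l c_l χ(v_l)⁻¹) χ(v_{l₀})` over all `χ`
  (Mathlib `DirichletCharacter.sum_char_inv_mul_char_eq`) leaves `φ(q) c_{l₀} = 0` because no `v_l = −v_{l₀}`
  (`Okada.cot_coeff_eq_zero`);
* (E) `linearIndependent_iff'` after casting the real relation to `ℂ` (`Complex.ofReal_cot`).

HONEST FRAMING (cells pub-zeta5 / zeta5-irr: systematic search; no irrationality claim unless
kernel-certified): a 1970/1981 linear-independence theorem about cotangent values made a kernel theorem;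
nothing here concerns `ζ(5)`; the statement file `OkadaLinearIndependence.lean` is untouched (its named
fact, the `k ≥ 2` Hurwitz form, was discharged by `OkadaLinearIndependenceProofs.lean`); the Chowla–Milnor
conjecture is untouched.
-/

noncomputable section

open Complex Real Finset Polynomial

namespace Literature.NumberTheory.Transcendental.Okada

variable {q : ℕ} [NeZero q]

/-! ### Step (A): the cotangent value as a rational polynomial in `ζ_q` -/

/-- `ζ_q^n = 𝕖(n mod q)` for `ζ_q = e^{2πi/q}`. [folklore] -/
private theorem exp_two_pi_pow_eq_stdAddChar (n : ℕ) :
    Complex.exp (2 * π * I / q) ^ n = ZMod.stdAddChar (n : ZMod q) := by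
  have h : ZMod.stdAddChar (n : ZMod q) = Complex.exp (2 * π * I * n / q) := by
    simpa using ZMod.stdAddChar_coe (N := q) (n : ℤ)
  rw [h, ← Complex.exp_nat_mul]
  congr 1
  ring

/-- The rational polynomial `C_x = Σ_{j<q} j X^{(jx)~}` evaluated at `ζ_q^t`:
`C_x(ζ_q^t) = Σ_{j<q} j 𝕖(j·xt)` — the Galois conjugates of `C_x(ζ_q)` are the same sums at the twisted
residue `xt`. [cite: Okada1981, Theorem (proof)] -/
theorem aeval_exp_pow_cotPoly (x : ZMod q) (t : ℕ) :
    aeval (Complex.exp (2 * π * I / q) ^ t)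
        (∑ j ∈ range q, C (j : ℚ) * X ^ (((j : ZMod q) * x).val)) =
      ∑ j ∈ range q, (j : ℂ) * ZMod.stdAddChar ((j : ZMod q) * (x * (t : ZMod q))) := by
  rw [map_sum]
  refine Finset.sum_congr rfl fun j _ => ?_
  rw [map_mul, aeval_C, map_pow, aeval_X, ← pow_mul, exp_two_pi_pow_eq_stdAddChar, eq_ratCast]
  push_cast
  rw [ZMod.natCast_zmod_val]
  congr 2
  ring

/-- **The finite Fourier expansion of the cotangent**, solved for the cotangent: for `x ≢ 0 (mod q)`,
`cot(π x̃/q) = i · (1 + (2/q) Σ_{j<q} j 𝕖(jx/q))` (from the tree's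
`q · π cot(π x̃/q) = πi (q + 2 Σ_{j<q} j 𝕖(jx/q))`; equivalently `i cot(πa/q) = (1 + ζ_q^a)/(1 − ζ_q^a)`).
[cite: GunRammurtyRath2011, Lemma 1 (proof)] -/
theorem cot_eq_I_mul {x : ZMod q} (hx : x ≠ 0) :
    Complex.cot (π * ((x.val : ℂ) / q)) =
      I * (1 + 2 / (q : ℂ) * ∑ j ∈ range q, (j : ℂ) * ZMod.stdAddChar ((j : ZMod q) * x)) := by
  have h := LFunctions.natCast_mul_pi_mul_cot_eq hx
  have hq : (q : ℂ) ≠ 0 := by exact_mod_cast NeZero.ne q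
  have hπ : (π : ℂ) ≠ 0 := Complex.ofReal_ne_zero.mpr Real.pi_ne_zero
  have h' : Complex.cot (π * ((x.val : ℂ) / q)) =
      (π * I * (q + 2 * ∑ j ∈ range q, (j : ℂ) * ZMod.stdAddChar ((j : ZMod q) * x))) / (q * π) := by
    rw [eq_div_iff (mul_ne_zero hq hπ), ← h]
    ring
  rw [h']
  field_simp

/-- If a rational polynomial vanishes at `ζ_q = e^{2πi/q}` then it vanishes at every primitive `q`-th root
`ζ_q^t`, `(t, q) = 1`: both have minimal polynomial `Φ_q` over `ℚ` (irreducibility of the cyclotomic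
polynomial; Mathlib `cyclotomic_eq_minpoly_rat`). [folklore] -/
private theorem aeval_exp_pow_eq_zero_of_aeval_eq_zero {P : ℚ[X]} (hP : aeval (Complex.exp (2 * π * I / q)) P = 0)
    {t : ℕ} (ht : t.Coprime q) : aeval (Complex.exp (2 * π * I / q) ^ t) P = 0 := by
  have hζ := Complex.isPrimitiveRoot_exp q (NeZero.ne q)
  have hζt := hζ.pow_of_coprime t ht
  have hpos : 0 < q := Nat.pos_of_ne_zero (NeZero.ne q)
  have hdvd : minpoly ℚ (Complex.exp (2 * π * I / q) ^ t) ∣ P := by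
    rw [← Polynomial.cyclotomic_eq_minpoly_rat hζt hpos, Polynomial.cyclotomic_eq_minpoly_rat hζ hpos]
    exact minpoly.dvd ℚ _ hP
  obtain ⟨Q, hQ⟩ := hdvd
  rw [hQ, map_mul, minpoly.aeval, zero_mul]

/-! ### Step (B): Galois transport of a rational relation among cotangent values -/

/-- **Galois transport.** If rational numbers `c_l` and units `v_l` mod `q` (`q ≥ 2`) satisfy
`Σ_l c_l cot(π ṽ_l/q) = 0`, then `Σ_l c_l cot(π (v_l t)~/q) = 0` for every `t` coprime to `q`: by step (A)
the relation says that `ζ_q` is a root of the rational polynomial `P = Σ_l c_l (1 + (2/q) C_{v_l})`, and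
`P(ζ_q^t) = 0` is the twisted relation. [cite: Okada1981, Theorem (proof)] -/
theorem cot_relation_transport (hq : 1 < q) {ι : Type*} (S : Finset ι) (c : ι → ℚ) (v : ι → ZMod q)
    (hunit : ∀ l ∈ S, IsUnit (v l))
    (h : ∑ l ∈ S, (c l : ℂ) * Complex.cot (π * (((v l).val : ℂ) / q)) = 0)
    {t : ℕ} (ht : t.Coprime q) :
    ∑ l ∈ S, (c l : ℂ) * Complex.cot (π * (((v l * (t : ZMod q)).val : ℂ) / q)) = 0 := by
  haveI : Fact (1 < q) := ⟨hq⟩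
  -- the polynomial `P = Σ_l c_l (1 + (2/q) C_{v_l})`
  set P : ℚ[X] := ∑ l ∈ S, C (c l) *
    (C 1 + C (2 / (q : ℚ)) * ∑ j ∈ range q, C (j : ℚ) * X ^ (((j : ZMod q) * v l).val)) with hPdef
  -- its value at `ζ_q^t` whenever all `v_l t ≢ 0`
  have hPeval : ∀ t : ℕ, (∀ l ∈ S, v l * (t : ZMod q) ≠ 0) →
      aeval (Complex.exp (2 * π * I / q) ^ t) P =
        -I * ∑ l ∈ S, (c l : ℂ) * Complex.cot (π * (((v l * (t : ZMod q)).val : ℂ) / q)) := by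
    intro t hne
    rw [hPdef, map_sum, Finset.mul_sum]
    refine Finset.sum_congr rfl fun l hl => ?_
    rw [map_mul, aeval_C, map_add, map_mul, aeval_C, aeval_C, aeval_exp_pow_cotPoly,
      cot_eq_I_mul (hne l hl)]
    simp only [eq_ratCast]
    push_cast
    have hI : I * I = -1 := Complex.I_mul_I
    linear_combination ((c l : ℂ) * (1 + 2 / (q : ℂ) *
      ∑ j ∈ range q, (j : ℂ) * ZMod.stdAddChar ((j : ZMod q) * (v l * (t : ZMod q))))) * hI
  -- at `t = 1` the relation gives `P(ζ_q) = 0`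
  have hP0 : aeval (Complex.exp (2 * π * I / q)) P = 0 := by
    have h1 := hPeval 1 (fun l hl => by
      rw [Nat.cast_one, mul_one]; exact (hunit l hl).ne_zero)
    rw [pow_one] at h1
    rw [h1]
    simp only [Nat.cast_one, mul_one]
    rw [h, mul_zero]
  -- hence `P(ζ_q^t) = 0`
  have hPt := aeval_exp_pow_eq_zero_of_aeval_eq_zero hP0 ht
  have hne : ∀ l ∈ S, v l * (t : ZMod q) ≠ 0 := by
    intro l hl
    have hu : IsUnit ((t : ZMod q)) := (ZMod.isUnit_iff_coprime t q).mpr ht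
    exact ((hunit l hl).mul hu).ne_zero
  rw [hPeval t hne] at hPt
  have hI0 : (-I : ℂ) ≠ 0 := neg_ne_zero.mpr I_ne_zero
  exact (mul_eq_zero.mp hPt).resolve_left hI0

/-! ### Step (D): the coefficients are orthogonal to the odd characters -/

/-- Twisting the character sum: for a unit `u` mod `q`, `Σ_r χ(r) f(ur) = χ(u⁻¹) Σ_r χ(r) f(r)`. [folklore] -/
private theorem sum_char_mul_comp_unit' (χ : DirichletCharacter ℂ q) (u : (ZMod q)ˣ) (f : ZMod q → ℂ) :
    ∑ r : ZMod q, χ r * f (u * r) = χ ((u : ZMod q)⁻¹) * ∑ r : ZMod q, χ r * f r := by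
  rw [Finset.mul_sum]
  have : ∀ r : ZMod q, χ r * f (u * r) = (fun y => χ ((u : ZMod q)⁻¹) * (χ y * f y)) (u.mulLeft r) := by
    intro r
    simp only [Units.mulLeft_apply]
    rw [← mul_assoc, ← map_mul, ← mul_assoc, ZMod.inv_coe_unit, Units.inv_mul, one_mul]
  simp_rw [this]
  exact Equiv.sum_comp (u.mulLeft) (fun y => χ ((u : ZMod q)⁻¹) * (χ y * f y))

/-- **Orthogonality to the odd characters.** If rational coefficients `c_l` at units `v_l` mod `q` satisfy the
twisted relations `Σ_l c_l cot(π (v_l t)~/q) = 0` for every `t` coprime to `q`, then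
`(1 − χ(−1)) · Σ_l c_l χ(v_l)⁻¹ = 0` for EVERY Dirichlet character `χ` mod `q`: for even `χ` the factor
vanishes; for odd `χ` multiply the relation at `t` by `χ(t)`, sum over `t`, and use
`Σ_r χ(r) cot(π r̃/q) = (2q/π) L(1, χ) ≠ 0`. [cite: Okada1981, Theorem (proof)] -/
theorem cot_sum_coeff_char_inv_eq_zero {ι : Type*} (S : Finset ι) (c : ι → ℚ) (v : ι → ZMod q)
    (hunit : ∀ l ∈ S, IsUnit (v l))
    (h : ∀ t : ℕ, t.Coprime q →
      ∑ l ∈ S, (c l : ℂ) * Complex.cot (π * (((v l * (t : ZMod q)).val : ℂ) / q)) = 0)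
    (χ : DirichletCharacter ℂ q) :
    (1 - χ (-1)) * ∑ l ∈ S, (c l : ℂ) * χ (v l)⁻¹ = 0 := by
  rcases χ.even_or_odd with he | ho
  · rw [he, sub_self, zero_mul]
  set w : ZMod q → ℂ := fun r => Complex.cot (π * ((r.val : ℂ) / q)) with hw
  -- the relation holds at every residue `r`, after multiplication by `χ r`
  have hr : ∀ r : ZMod q, χ r * ∑ l ∈ S, (c l : ℂ) * w (v l * r) = 0 := by
    intro r
    by_cases hru : IsUnit r
    · obtain ⟨u, rfl⟩ := hru
      have hcop := ZMod.val_coe_unit_coprime u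
      have := h (u : ZMod q).val hcop
      rw [ZMod.natCast_zmod_val] at this
      rw [this, mul_zero]
    · rw [MulChar.map_nonunit χ hru, zero_mul]
  have hsum : ∑ r : ZMod q, χ r * ∑ l ∈ S, (c l : ℂ) * w (v l * r) = 0 :=
    Finset.sum_eq_zero fun r _ => hr r
  -- swap the sums and twist each character sum back to `Σ_r χ(r) w(r)`
  have hswap : ∑ r : ZMod q, χ r * ∑ l ∈ S, (c l : ℂ) * w (v l * r) =
      (∑ l ∈ S, (c l : ℂ) * χ (v l)⁻¹) * ∑ r : ZMod q, χ r * w r := by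
    calc ∑ r : ZMod q, χ r * ∑ l ∈ S, (c l : ℂ) * w (v l * r)
        = ∑ r : ZMod q, ∑ l ∈ S, χ r * ((c l : ℂ) * w (v l * r)) :=
          Finset.sum_congr rfl fun r _ => Finset.mul_sum _ _ _
      _ = ∑ l ∈ S, ∑ r : ZMod q, χ r * ((c l : ℂ) * w (v l * r)) := Finset.sum_comm
      _ = ∑ l ∈ S, (c l : ℂ) * χ (v l)⁻¹ * ∑ r : ZMod q, χ r * w r := by
          refine Finset.sum_congr rfl fun l hl => ?_
          obtain ⟨u, hu⟩ := hunit l hl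
          have h1 : ∑ r : ZMod q, χ r * ((c l : ℂ) * w (v l * r)) =
              (c l : ℂ) * ∑ r : ZMod q, χ r * w (u * r) := by
            rw [Finset.mul_sum]
            refine Finset.sum_congr rfl fun r _ => ?_
            rw [hu]; ring
          rw [h1, sum_char_mul_comp_unit' χ u w, hu, mul_assoc]
      _ = (∑ l ∈ S, (c l : ℂ) * χ (v l)⁻¹) * ∑ r : ZMod q, χ r * w r := by rw [Finset.sum_mul]
  rw [hswap, hw] at hsum
  have hne := LFunctions.sum_char_mul_cot_ne_zero_of_odd ho
  rcases mul_eq_zero.mp hsum with hA | hB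
  · rw [hA, mul_zero]
  · exact absurd hB hne

/-! ### Step (D'): orthogonality of characters — every coefficient vanishes -/

/-- **Vanishing of the coefficients.** Under the hypotheses of `cot_sum_coeff_char_inv_eq_zero`, if moreover
the units `v_l` (`l ∈ S`) are pairwise distinct and no two of them are negatives of each other mod `q`, then
every `c_l = 0`: sum `(1 − χ(−1))(Σ_l c_l χ(v_l⁻¹))χ(v_{l₀}) = 0` over all characters `χ` and use
`Σ_χ χ(a⁻¹)χ(b) = φ(q)[a = b]` (Mathlib `DirichletCharacter.sum_char_inv_mul_char_eq`), which leaves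
`φ(q) · c_{l₀} = 0`. [cite: Okada1981, Theorem (proof)] -/
theorem cot_coeff_eq_zero {ι : Type*} (S : Finset ι) (c : ι → ℚ) (v : ι → ZMod q)
    (hunit : ∀ l ∈ S, IsUnit (v l))
    (hinj : ∀ l ∈ S, ∀ l' ∈ S, v l = v l' → l = l')
    (hneg : ∀ l ∈ S, ∀ l' ∈ S, v l ≠ -v l')
    (h : ∀ t : ℕ, t.Coprime q →
      ∑ l ∈ S, (c l : ℂ) * Complex.cot (π * (((v l * (t : ZMod q)).val : ℂ) / q)) = 0) :
    ∀ l ∈ S, c l = 0 := by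
  classical
  intro l₀ hl₀
  have hχ := cot_sum_coeff_char_inv_eq_zero S c v hunit h
  -- sum the vanishing quantities against `χ(v l₀)`
  have htot : ∑ χ : DirichletCharacter ℂ q,
      ((1 - χ (-1)) * ∑ l ∈ S, (c l : ℂ) * χ (v l)⁻¹) * χ (v l₀) = 0 :=
    Finset.sum_eq_zero fun χ _ => by rw [hχ χ, zero_mul]
  -- and evaluate the same sum by orthogonality
  have hcalc : ∑ χ : DirichletCharacter ℂ q,
      ((1 - χ (-1)) * ∑ l ∈ S, (c l : ℂ) * χ (v l)⁻¹) * χ (v l₀) =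
      ∑ l ∈ S, (c l : ℂ) * ((∑ χ : DirichletCharacter ℂ q, χ (v l)⁻¹ * χ (v l₀)) -
        ∑ χ : DirichletCharacter ℂ q, χ (v l)⁻¹ * χ (-(v l₀))) := by
    have hexp : ∀ χ : DirichletCharacter ℂ q,
        ((1 - χ (-1)) * ∑ l ∈ S, (c l : ℂ) * χ (v l)⁻¹) * χ (v l₀) =
        ∑ l ∈ S, (c l : ℂ) * (χ (v l)⁻¹ * χ (v l₀) - χ (v l)⁻¹ * χ (-(v l₀))) := by
      intro χ
      rw [Finset.mul_sum, Finset.sum_mul]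
      refine Finset.sum_congr rfl fun l _ => ?_
      rw [show (-(v l₀) : ZMod q) = (-1) * v l₀ by ring, map_mul]
      ring
    simp_rw [hexp]
    rw [Finset.sum_comm]
    refine Finset.sum_congr rfl fun l _ => ?_
    rw [← Finset.mul_sum, Finset.sum_sub_distrib]
  have horth : ∀ l ∈ S, ((∑ χ : DirichletCharacter ℂ q, χ (v l)⁻¹ * χ (v l₀)) -
        ∑ χ : DirichletCharacter ℂ q, χ (v l)⁻¹ * χ (-(v l₀))) =
      if l = l₀ then (q.totient : ℂ) else 0 := by
    intro l hl
    rw [DirichletCharacter.sum_char_inv_mul_char_eq ℂ (hunit l hl) (v l₀),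
      DirichletCharacter.sum_char_inv_mul_char_eq ℂ (hunit l hl) (-(v l₀)), if_neg (hneg l hl l₀ hl₀),
      sub_zero]
    by_cases hll : l = l₀
    · rw [if_pos hll, if_pos (by rw [hll])]
    · rw [if_neg hll, if_neg (fun h' => hll (hinj l hl l₀ hl₀ h'))]
  rw [hcalc, Finset.sum_congr rfl fun l hl => by rw [horth l hl]] at htot
  simp only [mul_ite, mul_zero, Finset.sum_ite_eq', if_pos hl₀] at htot
  have hφ : (q.totient : ℂ) ≠ 0 := by
    exact_mod_cast (Nat.totient_pos.mpr (Nat.pos_of_ne_zero (NeZero.ne q))).ne'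
  exact_mod_cast (mul_eq_zero.mp htot).resolve_right hφ

end Okada

/-! ### The theorem -/

open Okada in
/-- **Okada's theorem for `k = 1` on a general signed-free family of units (⊇ Chowla's theorem, and every
half-system `T` of the printed statement) — PROVED.** Let `q ≥ 2` and let `v_l` (`l ∈ ι`) be units
mod `q`, pairwise distinct, with `v_l ≢ −v_{l'}` for all `l, l'`. Then the real numbers `cot(π ṽ_l/q)`
(`ṽ_l ∈ [0, q)` the representative of `v_l`) are linearly independent over `ℚ`. In particular this holds
for every set `T` of `φ(q)/2` coprime residues with `T ∪ (−T) = (ℤ/q)^×` [Okada1981, Theorem, `k = 1`]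
= [GunRammurtyRath2011, Lemma 1, `k = 1`]. Proof: steps (A)–(E) of the module docstring.
[cite: Okada1981, Theorem] [cite: GunRammurtyRath2011, Lemma 1] -/
theorem okada_linearIndependent_cot_of_units {q : ℕ} (hq : 1 < q) {ι : Type*} (v : ι → ZMod q)
    (hunit : ∀ l, IsUnit (v l)) (hinj : Function.Injective v) (hneg : ∀ l l', v l ≠ -v l') :
    LinearIndependent ℚ fun l => Real.cot (π * (v l).val / q) := by
  haveI : NeZero q := ⟨by omega⟩
  rw [linearIndependent_iff']
  intro S g hsum l₀ hl₀
  -- the relation, cast to `ℂ`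
  have hrel : ∑ l ∈ S, (g l : ℂ) * Complex.cot (π * (((v l).val : ℂ) / q)) = 0 := by
    have h := congrArg (fun x : ℝ => (x : ℂ)) hsum
    simp only [Rat.smul_def, Complex.ofReal_sum, Complex.ofReal_mul, Complex.ofReal_ratCast,
      Complex.ofReal_zero] at h
    rw [← h]
    refine Finset.sum_congr rfl fun l _ => ?_
    push_cast
    ring_nf
  -- Galois transport
  have htw : ∀ t : ℕ, t.Coprime q →
      ∑ l ∈ S, (g l : ℂ) * Complex.cot (π * (((v l * (t : ZMod q)).val : ℂ) / q)) = 0 :=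
    fun t ht => cot_relation_transport hq S g v (fun l _ => hunit l) hrel ht
  exact cot_coeff_eq_zero S g v (fun l _ => hunit l) (fun l _ l' _ h => hinj h)
    (fun l _ l' _ => hneg l l') htw l₀ hl₀

open Okada in
/-- **Okada's theorem for `k = 1` = Chowla's cotangent theorem — PROVED.** For every integer `q ≥ 3`
the `φ(q)/2` real numbers `cot(πa/q)`, `1 ≤ a < q/2`, `(a, q) = 1`, are linearly independent over `ℚ`
(S. Chowla, J. Number Theory 2 (1970), for `q` prime; [Okada1981, Theorem] with `k = 1`;
[GunRammurtyRath2011, Lemma 1] with `k = 1`). The index type `{a : ℕ // 2a < q ∧ Nat.Coprime a q}` is the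
statement file's half-system (`a = 0` is excluded since `Nat.Coprime 0 q ↔ q = 1`); this is the case
`k = 1` that `OkadaLinearIndependence.lean` left as a TODO, now unconditional.
[cite: Okada1981, Theorem] [cite: GunRammurtyRath2011, Lemma 1] -/
theorem okada_linearIndependent_cot {q : ℕ} (hq : 3 ≤ q) :
    LinearIndependent ℚ fun a : {a : ℕ // 2 * a < q ∧ Nat.Coprime a q} =>
      Real.cot (π * (a : ℕ) / q) := by
  haveI : NeZero q := ⟨by omega⟩
  -- the half-system as a signed-free family of units
  have hunit : ∀ a : {a : ℕ // 2 * a < q ∧ Nat.Coprime a q}, IsUnit (((a.1 : ℕ) : ZMod q)) := fun a =>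
    (ZMod.isUnit_iff_coprime a.1 q).mpr a.2.2
  have hinj : Function.Injective fun a : {a : ℕ // 2 * a < q ∧ Nat.Coprime a q} => ((a.1 : ℕ) : ZMod q) := by
    intro a a' h
    have h1 : (a.1 : ℕ) < q := by have := a.2.1; omega
    have h2 : (a'.1 : ℕ) < q := by have := a'.2.1; omega
    simp only at h
    rw [ZMod.natCast_eq_natCast_iff] at h
    exact Subtype.ext (Nat.ModEq.eq_of_lt_of_lt h h1 h2)
  have hneg : ∀ a a' : {a : ℕ // 2 * a < q ∧ Nat.Coprime a q},
      ((a.1 : ℕ) : ZMod q) ≠ -((a'.1 : ℕ) : ZMod q) := by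
    intro a a' h
    have h1 : 2 * (a.1 : ℕ) < q := a.2.1
    have h2 : 2 * (a'.1 : ℕ) < q := a'.2.1
    have ha1 : (a.1 : ℕ) ≠ 0 := by
      intro h0
      have := a.2.2
      rw [h0, Nat.coprime_zero_left] at this
      omega
    have hsum0 : (((a.1 : ℕ) + (a'.1 : ℕ) : ℕ) : ZMod q) = 0 := by
      push_cast
      rw [h]; ring
    rw [ZMod.natCast_eq_zero_iff] at hsum0
    have := Nat.le_of_dvd (by omega) hsum0
    omega
  have hval : ∀ a : {a : ℕ // 2 * a < q ∧ Nat.Coprime a q}, (((a.1 : ℕ) : ZMod q)).val = a.1 := fun a =>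
    ZMod.val_cast_of_lt (by have := a.2.1; omega)
  convert okada_linearIndependent_cot_of_units (by omega) (fun a : {a : ℕ // 2 * a < q ∧ Nat.Coprime a q} =>
    ((a.1 : ℕ) : ZMod q)) hunit hinj hneg using 1
  funext a
  simp only [hval]

end Literature.NumberTheory.Transcendental
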